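import Summits.QuantumFields.YangMills.Theorems.BalabanUVNodesPortS1G3CResolvent
import Literature.Analysis.InnerProduct.KroneckerOperatorNorm

/-!
# NODE O port PT-A — `stub_G3C` helper (leaf (γ), any edition): THE `ℓ²`-OPERATOR NORM OF THE INVERSE OF A `Re`-COERCIVE KERNEL — `‖A⁻¹‖ ≤ 1/γ`, and `‖(x·1 + A)⁻¹‖ ≤ 1/γ` UNIFORMLY IN
# `x ≥ 0` (the operator-norm currency of the walk bound: per-step factors `‖T_Y‖·‖G_□‖ ≤ c₀e^{−δ₀d_j(Y)}/γ₀` carry NO index count, memo §5b)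

Cell `ym-nodeO-ideate`, porter hand `hand-27930-G3C` (g0); proof kind, `--supports stmt-QuantumFields-27930 --as helper`; count-neutral.  [16] = [Balaban1985UV3], [B9] = [Balaban1985BackgroundPropagators].

WHY.  The resummation of the repaired road (memo §5b, layer (D3)∕(D4)) bounds a walk term `Tr[G_{□₀}𝟙_{□₀}·S₁⋯Sₘ]` by `N_□·‖G_{□₀}‖·Π‖S_i‖` in the `ℓ²`-operator norm, where for a sticking-out piece of
linear size `≥ 1` the step is `‖T_Y·P·G_□·𝟙_□‖ ≤ ‖T_Y‖·‖G_□‖ ≤ c₀e^{−δ₀d_j(Y)}·γ₀⁻¹` — with NO factor `#indices per cube` (which would have to be beaten by `δ₀`, bound BEFORE `Mc` in `G3CAtRecordL`).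
So the local inverses need an OPERATOR-norm bound; ✓`…G3CResolvent` gave entries.  From `Re`-coercivity: `γ‖z‖² ≤ Re z^*Az ≤ ‖z‖‖Az‖`, so `‖Az‖ ≥ γ‖z‖` and `‖A⁻¹‖ ≤ γ⁻¹`
(✓`Literature.Analysis.InnerProduct.l2_opNorm_le_of_forall_norm_mulVec_le`); the `x`-vertex keeps coercivity (✓`G3CCT.reCoercive_realSmul_one_add`).

WHAT THIS FILE PROVES (sorry-free, generic finite index type): `G3CCT.sqrt_nsq_eq_norm` (`√nsq z = ‖toLp 2 z‖`), `G3CCT.norm_mulVec_ge_of_reCoercive` (`γ‖z‖ ≤ ‖Az‖`, no sign hypothesis on `γ`),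
★ `G3CCT.l2_opNorm_inv_le_of_reCoercive` (`‖A⁻¹‖ ≤ 1/γ`), ★ `G3CCT.l2_opNorm_resolvent_le_of_reCoercive` (`‖(x·1 + A)⁻¹‖ ≤ 1/γ`, `x ≥ 0`).

HONEST FRAMING.  Elementary; nothing of Bałaban's asserted, ported or discharged; `stub_G3C` NOT closed; 27930 OPEN; NODE O 0∕1; COUNT 8∕28 · K 1∕4 UNMOVED; finite `𝕋⁴` at fixed ε — NOT continuum ∕ OS ∕
Clay; **the Yang–Mills mass gap is NOT proved by any of this.**  No `sorry`, no `instance`, no `notation`, no `def`; standard axioms.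
-/

noncomputable section

open scoped BigOperators Matrix.Norms.L2Operator Matrix ComplexConjugate
open Finset Complex WithLp

namespace Summit.QuantumFields.YangMills.Theorems.BalabanUVNodesPortS1.G3CCT

open Literature.MathematicalPhysics.QuantumFieldTheory.Balaban1983to89.B5Prop11Lower (nsq nsq_nonneg norm_star_dotProduct_le)

variable {ι : Type*} [Fintype ι] [DecidableEq ι]

omit [DecidableEq ι] in
/-- `√(Σ|z_i|²)` is the Euclidean norm. [folklore] -/
theorem sqrt_nsq_eq_norm (z : ι → ℂ) : Real.sqrt (nsq z) = ‖(toLp 2 z : EuclideanSpace ℂ ι)‖ := by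
  rw [EuclideanSpace.norm_eq, nsq]

omit [DecidableEq ι] in
/-- **`γ‖z‖ ≤ ‖Az‖`** for a `Re`-coercive kernel (`γ > 0`). [folklore] -/
theorem norm_mulVec_ge_of_reCoercive {A : Matrix ι ι ℂ} {γ : ℝ} (h : ∀ z : ι → ℂ, γ * nsq z ≤ (star z ⬝ᵥ (A *ᵥ z)).re) (z : ι → ℂ) :
    γ * ‖(toLp 2 z : EuclideanSpace ℂ ι)‖ ≤ ‖(toLp 2 (A *ᵥ z) : EuclideanSpace ℂ ι)‖ := by
  rw [← sqrt_nsq_eq_norm, ← sqrt_nsq_eq_norm]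
  have h1 : γ * nsq z ≤ Real.sqrt (nsq z) * Real.sqrt (nsq (A *ᵥ z)) :=
    (h z).trans ((Complex.re_le_norm _).trans (norm_star_dotProduct_le z (A *ᵥ z)))
  by_cases hz : nsq z = 0
  · rw [hz, Real.sqrt_zero, mul_zero]; exact Real.sqrt_nonneg _
  · have hpos : 0 < Real.sqrt (nsq z) := Real.sqrt_pos.2 (lt_of_le_of_ne (nsq_nonneg z) (Ne.symm hz))
    have e : nsq z = Real.sqrt (nsq z) * Real.sqrt (nsq z) := (Real.mul_self_sqrt (nsq_nonneg z)).symm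
    have h2 : γ * Real.sqrt (nsq z) * Real.sqrt (nsq z) ≤ Real.sqrt (nsq (A *ᵥ z)) * Real.sqrt (nsq z) := by
      calc γ * Real.sqrt (nsq z) * Real.sqrt (nsq z) = γ * nsq z := by rw [mul_assoc, ← e]
        _ ≤ Real.sqrt (nsq z) * Real.sqrt (nsq (A *ᵥ z)) := h1
        _ = Real.sqrt (nsq (A *ᵥ z)) * Real.sqrt (nsq z) := mul_comm _ _
    exact le_of_mul_le_mul_right h2 hpos

/-- ★ **`‖A⁻¹‖ ≤ 1/γ`** in the `ℓ²`-operator norm for a `Re`-coercive kernel. [folklore] -/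
theorem l2_opNorm_inv_le_of_reCoercive {A : Matrix ι ι ℂ} {γ : ℝ} (hγ : 0 < γ) (h : ∀ z : ι → ℂ, γ * nsq z ≤ (star z ⬝ᵥ (A *ᵥ z)).re) :
    ‖A⁻¹‖ ≤ 1 / γ := by
  have hdet : IsUnit A.det := isUnit_det_of_reCoercive hγ h
  refine Literature.Analysis.InnerProduct.l2_opNorm_le_of_forall_norm_mulVec_le A⁻¹ (by positivity) fun v => ?_
  have hz := norm_mulVec_ge_of_reCoercive h (A⁻¹ *ᵥ ofLp v)
  rw [Matrix.mulVec_mulVec, Matrix.mul_nonsing_inv _ hdet, Matrix.one_mulVec, toLp_ofLp] at hz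
  rw [one_div, le_inv_mul_iff₀ hγ]
  exact hz

/-- ★ **`‖(x·1 + A)⁻¹‖ ≤ 1/γ` UNIFORMLY in `x ≥ 0`** («G̃₃(x) has the same properties as G̃₂», [16] p.272). [cite: Balaban1985UV3, p.272 (after (63))] -/
theorem l2_opNorm_resolvent_le_of_reCoercive {A : Matrix ι ι ℂ} {γ : ℝ} (hγ : 0 < γ) (h : ∀ z : ι → ℂ, γ * nsq z ≤ (star z ⬝ᵥ (A *ᵥ z)).re)
    {x : ℝ} (hx : 0 ≤ x) : ‖(((x : ℂ) • (1 : Matrix ι ι ℂ) + A))⁻¹‖ ≤ 1 / γ :=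
  l2_opNorm_inv_le_of_reCoercive hγ (reCoercive_realSmul_one_add h hx)

end Summit.QuantumFields.YangMills.Theorems.BalabanUVNodesPortS1.G3CCT

end
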